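import Mathlib
import Summits.KontsevichZagierPeriods.KontsevichZagierPeriods.Theorems.HyperbolicBlochZagierDilogarithmConjectureStubBorelSlice
import Summits.KontsevichZagierPeriods.KontsevichZagierPeriods.Theorems.HyperbolicBlochTetraSector
import Literature.NumberTheory.Transcendental.BlochWignerDilogarithmVolumeProofs
import HarnessLib

/-!
# `ZagierDilogarithmConjecture` (stmt-KontsevichZagierPeriods-10550) — line
`kummer-clausen-linearisation` (reshape c1), by-product stub `stub_subSector` (route level)

**The Borel sub-sector of Kontsevich–Zagier's Conjecture 1 (kernel form, weight 2).** What the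
route's deciding theorem `closes` consumes from `hZ` is TetraSector's conclusion: for the standard
ideal tetrahedra `T(zᵢ)` (`zᵢ ∈ ℚ̄ ∩ ℍ⁺`) and any KZ representations `ρ zᵢ = [T(zᵢ), t⁻³]`,
`Σ nᵢ value(ρ zᵢ) = 0 ⇒ Σ nᵢ[ρ zᵢ] ∈ KZ.relations`. This file proves THAT statement on the Borel
slice (zero Dehn invariant, shapes in a number field with one complex place), given Dupont 2001
Thm. 10.24 a): values are volumes are Bloch–Wigner values (`idealTetrahedronVolume_eq_blochWignerDilog`,
proved), the slice `stub_borelSlice` puts `Σ nᵢ[zᵢ]` in `⟨dilogRelators⟩`, and the proved five-term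
transfer theorem `FiveTermTransfer_of` turns every relator into a KZ relation exactly as in
`sectorReduction_proof`. Sorry-free; conditional only on the named fact (explicit hypothesis).
-/

noncomputable section

open scoped BigOperators ComplexConjugate
open Literature.NumberTheory.Transcendental
open FreeAbelianGroup (of lift_apply_of)
open Summit.KontsevichZagierPeriods.HyperbolicBloch.ZagierDilogarithmConjectureNegative
  (ext ext_of_ne sym asym dehn dehn_of)

namespace Summit.KontsevichZagierPeriods.HyperbolicBloch.ZagierDilogarithmBorelSlice

/-! ## §4 The sub-sector of Conjecture 1 (route level) -/

/-- **The Borel sub-sector of Kontsevich–Zagier's Conjecture 1 (kernel form, weight 2).** For the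
standard ideal tetrahedra `T(zᵢ)` with algebraic shapes `zᵢ` in a conjugation-closed number field with
one complex place and any KZ representations `ρ zᵢ = [T(zᵢ), t⁻³]`: if the formal combination
`Σ nᵢ[zᵢ]` has zero Dehn invariant, then `Σ nᵢ · value(ρ zᵢ) = 0` implies `Σ nᵢ[ρ zᵢ] ∈ KZ.relations` —
GIVEN Dupont 2001 Thm. 10.24 a). (Values are volumes are `D(zᵢ)` — `idealTetrahedronVolume_eq_blochWignerDilog`,
proved; the slice puts `Σ nᵢ[zᵢ]` in `⟨dilogRelators⟩`; the five-term transfer theorem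
`FiveTermTransfer_of` (proved) turns every relator into a KZ relation, as in `sectorReduction_proof`.)
[cite: Dupont2001, Thm. 10.24 a)] -/
theorem stub_subSector :
    Dupont2001_preBloch_relation_of_invariants →
    ∀ (T : ℂ → Set (Fin 3 → ℝ)), (∀ z, T z = {p | 0 < p 1 ∧ z.re * p 1 < z.im * p 0 ∧
      z.im * (p 0 - 1) < (z.re - 1) * p 1 ∧ 0 < p 2 ∧
      0 < z.im * (p 0 ^ 2 + p 1 ^ 2 + p 2 ^ 2 - p 0) + (z.re - Complex.normSq z) * p 1}) →
    ∀ (ρ : ℂ → KZ.IntegralRep 3), (∀ z, IsAlgebraic ℚ z → 0 < z.im →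
      (ρ z).domain = T z ∧ Set.EqOn (ρ z).integrand (fun p => 1 / p 2 ^ 3) (T z)) →
    ∀ (k : ℕ) (z : Fin k → ℂ) (n : Fin k → ℤ), (∀ i, IsAlgebraic ℚ (z i)) → (∀ i, 0 < (z i).im) →
      (∀ u v : Additive ℂˣ →+ ℚ, dehn u v (∑ i, n i • FreeAbelianGroup.of (z i)) = 0) →
      (∃ K : IntermediateField ℚ ℂ, FiniteDimensional ℚ K ∧ (∀ i, z i ∈ K) ∧
          ∀ σ : K →+* ℂ, (∀ x : K, σ x = (x : ℂ)) ∨ (∀ x : K, σ x = (starRingEnd ℂ) (x : ℂ)) ∨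
            (∀ x : K, (σ x).im = 0)) →
      ∑ i, (n i : ℝ) * (ρ (z i)).value = 0 →
        (∑ i, n i • KZ.of (ρ (z i))) ∈ KZ.relations := by
  intro hD T hT ρ hρ k z n halg him hdehn hK hsum
  -- (1) values are volumes are Bloch–Wigner values
  have hTz : ∀ w, T w = idealTetrahedron w := fun w => hT w
  have hval : ∀ i, (ρ (z i)).value = blochWignerDilog (z i) := by
    intro i
    rw [SectorReduction.value_eq_setIntegral_of_eqOn (hρ (z i) (halg i) (him i)).1
      (hρ (z i) (halg i) (him i)).2, hTz,
      ← BlochWignerVolume.idealTetrahedronVolume_eq_blochWignerDilog (him i)]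
    rfl
  have hsum' : ∑ i, (n i : ℝ) * blochWignerDilog (z i) = 0 := by simpa only [hval] using hsum
  -- (2) the slice
  have hmem := stub_borelSlice hD k z n halg him hdehn hK hsum'
  -- (3) transfer: every relator is a KZ relation (`FiveTermTransfer_of`, as in `sectorReduction_proof`)
  obtain ⟨B, hB⟩ : ∃ B : ℂ → KZ.FormalRep, ∀ w, B w = if 0 < w.im then KZ.of (ρ w)
      else if w.im < 0 then -KZ.of (ρ (conj w)) else 0 := ⟨_, fun _ => rfl⟩
  let φ : FreeAbelianGroup ℂ →+ KZ.FormalRep := FreeAbelianGroup.lift B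
  have hφ : ∀ w, φ (FreeAbelianGroup.of w) = B w := fun w => FreeAbelianGroup.lift_apply_of _ _
  have hle : AddSubgroup.closure dilogRelators ≤ KZ.relations.comap φ := by
    rw [AddSubgroup.closure_le]
    rintro c ((⟨x, y, hx, hy, hx0, hx1, hy0, hy1, hxy, rfl⟩ | ⟨w, -, rfl⟩) | ⟨w, hw, rfl⟩)
    · simp only [SetLike.mem_coe, AddSubgroup.mem_comap, map_add, map_sub, hφ]
      exact FiveTerm.FiveTermTransfer_of T hT ρ hρ B hB x y hx hy hx0 hx1 hy0 hy1 hxy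
    · simp only [SetLike.mem_coe, AddSubgroup.mem_comap, map_add, hφ]
      rw [SectorReduction.B_add_B_conj_eq_zero ρ B hB w]
      exact zero_mem _
    · simp only [SetLike.mem_coe, AddSubgroup.mem_comap, hφ]
      rw [SectorReduction.B_eq_zero_of_im_eq_zero ρ B hB w hw]
      exact zero_mem _
  have hφsum : φ (∑ i, n i • FreeAbelianGroup.of (z i)) = ∑ i, n i • KZ.of (ρ (z i)) := by
    rw [map_sum]
    refine Finset.sum_congr rfl fun i _ => ?_
    rw [map_zsmul, hφ, hB, if_pos (him i)]
  have h2 : (∑ i, n i • FreeAbelianGroup.of (z i)) ∈ KZ.relations.comap φ := hle hmem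
  rwa [AddSubgroup.mem_comap, hφsum] at h2


end Summit.KontsevichZagierPeriods.HyperbolicBloch.ZagierDilogarithmBorelSlice

end
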